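import Summits.AtomisticToContinuum.FouriersLaw.Theorems.BondHeatUncertaintyExtensiveSnapshotIrreversibilityEnergyWindowSkeletonWeights
import Summits.AtomisticToContinuum.FouriersLaw.Theorems.BondHeatUncertaintyExtensiveSnapshotIrreversibilityEnergyWindowFlowJacobian

/-!
# Energy window, part T-a (file 1 of 2) — a skeleton direction is an adapted noise shift: the pathwise
first-variation bound, and the second-variation leaf (JMˣ)₂

Lineage `stmt-AtomisticToContinuum-9121` (`ExtensiveSnapshotIrreversibility`), K_fix half, leaf S3
`KernelTemperatureLipschitz`; record S3 ⟸ (Dˢ) ∧ (G1ℓ) ∧ (G1*ᶜᶜ) [Rᵇ], (G1ℓ) ⟸ (SWM) ∧ (JM),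
(G1*ᶜᶜ) ⟸ (SWM) (glue parts S–V).  Cell decomp-a2c, lens «grading / quantitative ladder», generation 79,
part T «SkeletonIdentities» (critic rows 1077 (d), 1086 (c), 1093 (g)) = five files: T-a
`…SkeletonVariation` (§1–§3, §6) → `…SkeletonJacobianMoments` (§4–§5) and T-b `…SkeletonCoordinates`
(§1–§3) → `…SkeletonRegularity` (§4) → `…SkeletonIdentities` (§5–§6); section numbers refer to the
part (T-a resp. T-b) as a whole.

THIS FILE (T-a §1–§3, §6).  Critic row 1077 (d) / 1093 (g): «(JMˣ) tried FIRST as S′p §4 with `momShift`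
replaced by the skeleton directions; a named leaf only if a skeleton direction is NOT realisable as a
constant/adapted noise shift of the same flow».  A level-`m` skeleton direction `δ` IS so realisable:
`x ↦ E^{s}_{m,z,r}(x + εδ)` is the flow driven by the original noise shifted by `ε H δ`, `H δ =
skelForcing … δ` the piecewise-linear (deterministic given the skeleton) ramp, and R
`fderiv_skelFlowMapAt_apply_eq_variation` identifies `D_x E[δ]` with the tree's first-variation process
`pinnedChainVariation … (H δ)`, i.e. the integral equation `w(τ) = (0, (Hδ)(τ)) + ∫₀^τ DY(X_u) w(u) du`
with a BOUNDED time-dependent inhomogeneity.  Hence no leaf for the first variation: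
* §1 `skelAbsSum`, `norm_skelForcing_apply_le` — `‖(Hδ)(τ)‖ ≤ max(|c_L|,|c_R|)·(∑|δ₁ k| + ∑|δ₂ k|)`
  (tent coefficients lie in `[0,1]`); a basis direction has size `1`, uniformly in the level.
* §2 `norm_le_mul_exp_integral_of_eq_add_integral_of_norm_le` — S′a's variable-coefficient Grönwall
  WITH a bounded inhomogeneity: `w = f + ∫₀ A w`, `‖f‖ ≤ F`, `‖A(u)‖ ≤ a(u)` ⇒ `‖w t‖ ≤ F exp ∫₀ᵗ a`.
* §3 `norm_fderiv_skelFlowMapAt_le` — for EVERY remainder `r`, skeleton `x`, direction `δ`, `s ∈ [0,1]`: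
  `‖D_x X_s^{m}(z,r,x)[δ]‖ ≤ max(|c_L|,|c_R|) · skelAbsSum δ · exp(∫₀ˢ (A₀ + A₁√H(X_u)) du)`
  (S′a `norm_fderiv_drift_apply_le` for `‖DY‖ ≤ A₀ + A₁√H`).
* §6 the ONE named leaf of part T, **(JMˣ)₂ `SkeletonSecondVariationMoments`**: the SECOND skeleton
  variation `D²_x E[δ,δ']` solves the variational equation with the BILINEAR source
  `D²Y(X_u)[w_δ(u), w_δ'(u)]` — it is not the response of the flow to any noise shift (such responses
  solve the homogeneous first-variation equation plus an additive forcing), so by the row-1077 (d) test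
  it is typed, not proved here; `fderiv_fderiv_skelFlowMapAt_zero` records that its integrand vanishes
  in the zero direction.  File 2 (`…SkeletonJacobianMoments`, §4–§5) turns §3 into moments: (JMˣ)₁.
No instance / notation / option; no proof holes.
References: N. Cuneo, J.-P. Eckmann, M. Hairer, L. Rey-Bellet, Electron. J. Probab. 23 (2018), §3
eq. (3.4) [cite: CuneoEckmannHairerReyBellet2018, §3 eq. (3.4)]; D. Nualart, The Malliavin Calculus and
Related Topics (2006), §2.2 (the shape `D_h X_t = ∫ J_{t,u} σ ḣ(u) du`). [folklore]
-/

noncomputable section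

namespace Summit.AtomisticToContinuum.FouriersLaw.Theorems.ExtensiveSnapshotIrreversibility.EnergyWindow

open MeasureTheory Filter Topology Real unitInterval Set
open scoped ENNReal NNReal ContDiff
open Literature.MathematicalPhysics.KineticTheory.HeatConduction
open Literature.Probability.Process Literature.Analysis.ODE

/-! ## 1. The size of a skeleton direction; sup bound on its forcing -/

/-- The `ℓ¹` size `∑_k |δ₁ k| + ∑_k |δ₂ k|` of a level-`m` skeleton direction. [folklore] -/
def skelAbsSum {m : ℕ} (δ : PairSkeleton m) : ℝ := ∑ k, |δ.1 k| + ∑ k, |δ.2 k|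

/-- `skelAbsSum δ ≥ 0`. [folklore] -/
theorem skelAbsSum_nonneg {m : ℕ} (δ : PairSkeleton m) : 0 ≤ skelAbsSum δ := by
  unfold skelAbsSum; positivity

/-- The left basis direction `(e_k, 0)` has size `1` (uniformly in the level). [folklore] -/
theorem skelAbsSum_single_fst (m : ℕ) (k : Fin (2 ^ m)) :
    skelAbsSum ((Pi.single k 1, 0) : PairSkeleton m) = 1 := by
  unfold skelAbsSum
  simp only [Pi.zero_apply, abs_zero, Finset.sum_const_zero, add_zero]
  rw [Finset.sum_eq_single k (fun j _ hj => by simp [hj])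
    (fun h => absurd (Finset.mem_univ k) h)]
  simp

/-- The right basis direction `(0, e_k)` has size `1`. [folklore] -/
theorem skelAbsSum_single_snd (m : ℕ) (k : Fin (2 ^ m)) :
    skelAbsSum ((0, Pi.single k 1) : PairSkeleton m) = 1 := by
  unfold skelAbsSum
  simp only [Pi.zero_apply, abs_zero, Finset.sum_const_zero, zero_add]
  rw [Finset.sum_eq_single k (fun j _ hj => by simp [hj])
    (fun h => absurd (Finset.mem_univ k) h)]
  simp

/-- `|PL^m_x(u)| ≤ ∑_k |x_k|` (the tent coefficients lie in `[0, 1]`). [folklore] -/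
theorem abs_plInterp_le (m : ℕ) (x : Fin (2 ^ m) → ℝ) (u : ℝ≥0) :
    |plInterp m x u| ≤ ∑ k, |x k| := by
  unfold plInterp
  refine (Finset.abs_sum_le_sum_abs _ _).trans (Finset.sum_le_sum fun k _ => ?_)
  have ht := tentCoeff_mem_Icc m (k : ℕ) u
  rw [abs_mul, abs_of_nonneg ht.1]
  exact mul_le_of_le_one_right (abs_nonneg _) ht.2

/-- **Sup bound on the skeleton forcing**: `‖(H δ)(τ)‖ ≤ max(|c_L|, |c_R|) · skelAbsSum δ` for
every `τ ∈ [0, 1]`. [folklore] -/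
theorem norm_skelForcing_apply_le (N m : ℕ) (c_L c_R : ℝ) (δ : PairSkeleton m) (τ : I) :
    ‖skelForcing N m c_L c_R δ τ‖ ≤ max |c_L| |c_R| * skelAbsSum δ := by
  have hA : 0 ≤ ∑ k, |δ.1 k| := Finset.sum_nonneg fun k _ => abs_nonneg _
  have hB : 0 ≤ ∑ k, |δ.2 k| := Finset.sum_nonneg fun k _ => abs_nonneg _
  have h0 : 0 ≤ max |c_L| |c_R| * skelAbsSum δ :=
    mul_nonneg (le_max_of_le_left (abs_nonneg _)) (skelAbsSum_nonneg δ)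
  refine (pi_norm_le_iff_of_nonneg h0).2 fun i => ?_
  rw [Real.norm_eq_abs, skelForcing_apply]
  have h1 : |(if i.val = 0 then c_L else 0) * plInterp m δ.1 (toNN τ)| ≤ |c_L| * ∑ k, |δ.1 k| := by
    rw [abs_mul]
    refine mul_le_mul ?_ (abs_plInterp_le m δ.1 _) (abs_nonneg _) (abs_nonneg _)
    split_ifs <;> simp
  have h2 : |(if i.val = N - 1 then c_R else 0) * plInterp m δ.2 (toNN τ)| ≤
      |c_R| * ∑ k, |δ.2 k| := by
    rw [abs_mul]
    refine mul_le_mul ?_ (abs_plInterp_le m δ.2 _) (abs_nonneg _) (abs_nonneg _)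
    split_ifs <;> simp
  calc |(if i.val = 0 then c_L else 0) * plInterp m δ.1 (toNN τ) +
          (if i.val = N - 1 then c_R else 0) * plInterp m δ.2 (toNN τ)|
        ≤ |(if i.val = 0 then c_L else 0) * plInterp m δ.1 (toNN τ)| +
          |(if i.val = N - 1 then c_R else 0) * plInterp m δ.2 (toNN τ)| := abs_add_le _ _
    _ ≤ |c_L| * ∑ k, |δ.1 k| + |c_R| * ∑ k, |δ.2 k| := add_le_add h1 h2
    _ ≤ max |c_L| |c_R| * ∑ k, |δ.1 k| + max |c_L| |c_R| * ∑ k, |δ.2 k| :=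
        add_le_add (mul_le_mul_of_nonneg_right (le_max_left _ _) hA)
          (mul_le_mul_of_nonneg_right (le_max_right _ _) hB)
    _ = max |c_L| |c_R| * skelAbsSum δ := by rw [skelAbsSum, mul_add]

/-- The momentum lift `(0, (Hδ)(τ))` of the forcing has the same sup bound (sup norm on phase
space). [folklore] -/
theorem norm_inr_skelForcing_apply_le (N m : ℕ) (c_L c_R : ℝ) (δ : PairSkeleton m) (τ : I) :
    ‖(((0 : Fin N → ℝ), skelForcing N m c_L c_R δ τ) : PhaseSpace N)‖ ≤
      max |c_L| |c_R| * skelAbsSum δ := by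
  rw [Prod.norm_mk, norm_zero, max_eq_right (norm_nonneg _)]
  exact norm_skelForcing_apply_le N m c_L c_R δ τ

/-! ## 2. Grönwall with a bounded time-dependent inhomogeneity -/

/-- **Grönwall, linear integral equation, variable coefficient, bounded inhomogeneity.** If `w` is
continuous, `w(t) = f(t) + ∫₀ᵗ A(s) (w s) ds` on `[0, T]` with `‖f‖ ≤ F` there, and
`‖A(s) v‖ ≤ a(s) ‖v‖` with `a ≥ 0` continuous, then `‖w(t)‖ ≤ F · exp(∫₀ᵗ a)` on `[0, T]`
(S′a's majorant argument with `‖w₀‖` replaced by `F`). [folklore] -/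
theorem norm_le_mul_exp_integral_of_eq_add_integral_of_norm_le {E : Type*} [NormedAddCommGroup E]
    [NormedSpace ℝ E] [CompleteSpace E] {w f : ℝ → E} {A : ℝ → E →L[ℝ] E} {a : ℝ → ℝ} {F T : ℝ}
    (hw : Continuous w) (hA : Continuous A) (ha : Continuous a)
    (hAa : ∀ t v, ‖A t v‖ ≤ a t * ‖v‖) (ha0 : ∀ t, 0 ≤ a t)
    (hf : ∀ t ∈ Icc (0 : ℝ) T, ‖f t‖ ≤ F)
    (heq : ∀ t ∈ Icc (0 : ℝ) T, w t = f t + ∫ s in (0 : ℝ)..t, A s (w s)) {t : ℝ}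
    (ht : t ∈ Icc (0 : ℝ) T) :
    ‖w t‖ ≤ F * Real.exp (∫ s in (0 : ℝ)..t, a s) := by
  have hgc : Continuous fun s => a s * ‖w s‖ := ha.mul hw.norm
  have hwR : ∀ u ∈ Icc (0 : ℝ) T, ‖w u‖ ≤ F + ∫ s in (0 : ℝ)..u, a s * ‖w s‖ := by
    intro u hu
    rw [heq u hu]
    refine (norm_add_le _ _).trans (add_le_add (hf u hu) ?_)
    refine (intervalIntegral.norm_integral_le_integral_norm hu.1).trans ?_
    exact intervalIntegral.integral_mono_on hu.1 ((hA.clm_apply hw).norm.intervalIntegrable _ _)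
      (hgc.intervalIntegrable _ _) fun s _ => hAa s (w s)
  have hRd : ∀ u, HasDerivAt (fun u => F + ∫ s in (0 : ℝ)..u, a s * ‖w s‖) (a u * ‖w u‖) u :=
    fun u => (intervalIntegral.integral_hasDerivAt_right (hgc.intervalIntegrable 0 u)
      (hgc.stronglyMeasurableAtFilter _ _) hgc.continuousAt).const_add _
  have hBd : ∀ u, HasDerivAt (fun u => ∫ s in (0 : ℝ)..u, a s) (a u) u := fun u =>
    intervalIntegral.integral_hasDerivAt_right (ha.intervalIntegrable 0 u)
      (ha.stronglyMeasurableAtFilter _ _) ha.continuousAt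
  set Φ : ℝ → ℝ := fun u =>
    (F + ∫ s in (0 : ℝ)..u, a s * ‖w s‖) * Real.exp (-∫ s in (0 : ℝ)..u, a s) with hΦ
  have hΦd : ∀ u, HasDerivAt Φ (a u * ‖w u‖ * Real.exp (-∫ s in (0 : ℝ)..u, a s) +
      (F + ∫ s in (0 : ℝ)..u, a s * ‖w s‖) *
        (Real.exp (-∫ s in (0 : ℝ)..u, a s) * -a u)) u :=
    fun u => (hRd u).mul (hBd u).neg.exp
  have hanti : AntitoneOn Φ (Icc 0 T) := by
    refine antitoneOn_of_deriv_nonpos (convex_Icc 0 T)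
      (fun u _ => (hΦd u).continuousAt.continuousWithinAt)
      (fun u _ => (hΦd u).differentiableAt.differentiableWithinAt) fun u hu => ?_
    rw [interior_Icc] at hu
    rw [(hΦd u).deriv]
    have h1 : a u * ‖w u‖ ≤ a u * (F + ∫ s in (0 : ℝ)..u, a s * ‖w s‖) :=
      mul_le_mul_of_nonneg_left (hwR u (Ioo_subset_Icc_self hu)) (ha0 u)
    have h2 : a u * ‖w u‖ * Real.exp (-∫ s in (0 : ℝ)..u, a s) +
        (F + ∫ s in (0 : ℝ)..u, a s * ‖w s‖) * (Real.exp (-∫ s in (0 : ℝ)..u, a s) * -a u) =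
        Real.exp (-∫ s in (0 : ℝ)..u, a s) *
          (a u * ‖w u‖ - a u * (F + ∫ s in (0 : ℝ)..u, a s * ‖w s‖)) := by ring
    rw [h2]
    exact mul_nonpos_of_nonneg_of_nonpos (Real.exp_pos _).le (by linarith)
  have h0T : (0 : ℝ) ∈ Icc 0 T := ⟨le_rfl, ht.1.trans ht.2⟩
  have hΦ0 : Φ 0 = F := by simp [hΦ]
  have hle : Φ t ≤ F := hΦ0 ▸ hanti h0T ht ht.1
  have hexp : (F + ∫ s in (0 : ℝ)..t, a s * ‖w s‖) ≤ F * Real.exp (∫ s in (0 : ℝ)..t, a s) := by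
    have h := mul_le_mul_of_nonneg_right hle (Real.exp_pos (∫ s in (0 : ℝ)..t, a s)).le
    have h' : Φ t * Real.exp (∫ s in (0 : ℝ)..t, a s) = F + ∫ s in (0 : ℝ)..t, a s * ‖w s‖ := by
      simp only [hΦ]
      rw [mul_assoc, ← Real.exp_add, neg_add_cancel, Real.exp_zero, mul_one]
    linarith
  exact (hwR t ht).trans hexp

/-! ## 3. The pathwise bound on the skeleton-direction Jacobians, for every remainder -/

section Pathwise

variable {ω₂ lam β γ : ℝ} (hω : 0 < ω₂) (hl : 0 ≤ lam) (hβ : 0 ≤ β) (hγ : 0 ≤ γ) (N : ℕ)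
  (T_L T_R : ℝ)

include hω hl hβ hγ in
/-- The skeleton flow is continuous in time (for every remainder and skeleton). [folklore] -/
theorem continuous_skelFlowMapAt_time (m : ℕ) (z : PhaseSpace N) (r : WienerPair)
    (x : PairSkeleton m) :
    Continuous fun u => skelFlowMapAt ω₂ lam β γ N T_L T_R u m z r x := by
  have h := pinnedChain_continuous_chainFlow hω hl hβ hγ N z
    (continuous_perturbedNoise (continuous_chainNoise_rem ω₂ lam β γ N T_L T_R r)
      (skelForcing N m (ampL ω₂ lam β γ T_L) (ampR ω₂ lam β γ T_R)) x)
  exact h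

include hω hl hβ hγ in
/-- **Pathwise Grönwall bound for the skeleton-direction Jacobian**, for EVERY remainder `r`,
skeleton `x`, direction `δ` and `s ∈ [0, 1]`:
`‖D_x X_s^{m}(z, r, x)[δ]‖ ≤ max(|c_L|, |c_R|) · skelAbsSum δ · exp(∫₀ˢ (A₀ + A₁ √H(X_u^{m}(z,r,x))) du)`
— the derivative is the variational solution of `LangevinChainVariational` for the forcing family
`skelForcing` (`fderiv_skelFlowMapAt_apply`), whose inhomogeneity `(0, (Hδ)(τ))` is bounded (§1);
§2 and S′a's drift bound conclude. [folklore] -/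
theorem norm_fderiv_skelFlowMapAt_le {s : ℝ} (hs : s ∈ Icc (0 : ℝ) 1) (m : ℕ) (z : PhaseSpace N)
    (r : WienerPair) (x δ : PairSkeleton m) :
    ‖fderiv ℝ (skelFlowMapAt ω₂ lam β γ N T_L T_R s m z r) x δ‖ ≤
      max |ampL ω₂ lam β γ T_L| |ampR ω₂ lam β γ T_R| * skelAbsSum δ *
        Real.exp (∫ u in (0 : ℝ)..s, (driftA₀ ω₂ γ N + driftA₁ lam β N *
          √((pinnedChain ω₂ lam β γ).hamiltonian N
            (skelFlowMapAt ω₂ lam β γ N T_L T_R u m z r x)))) := by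
  have hη₀ : Continuous (chainNoise N (ampL ω₂ lam β γ T_L) (ampR ω₂ lam β γ T_R) r) :=
    continuous_chainNoise_rem ω₂ lam β γ N T_L T_R r
  set w : ℝ → PhaseSpace N := pinnedChainVariation hω hl hβ hγ N z hη₀
    (skelForcing N m (ampL ω₂ lam β γ T_L) (ampR ω₂ lam β γ T_R)) x δ with hw_def
  -- the integral equation of `w` on `[0, 1]`, with the bounded ramp inhomogeneity
  have heq : ∀ τ ∈ Icc (0 : ℝ) 1, w τ =
      (((0 : Fin N → ℝ), IccExtend zero_le_one
          (skelForcing N m (ampL ω₂ lam β γ T_L) (ampR ω₂ lam β γ T_R) δ) τ) : PhaseSpace N) +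
        ∫ u in (0 : ℝ)..τ, (fderiv ℝ ((pinnedChain ω₂ lam β γ).drift N)
          (skelFlowMapAt ω₂ lam β γ N T_L T_R u m z r x)) (w u) := by
    intro τ hτ
    have h := pinnedChainVariation_eq hω hl hβ hγ N z hη₀
      (skelForcing N m (ampL ω₂ lam β γ T_L) (ampR ω₂ lam β γ T_R)) x δ hτ
    rw [hw_def, h, IccExtend_of_mem _ _ hτ]
    rfl
  have hw : Continuous w := continuous_pinnedChainVariation hω hl hβ hγ N z hη₀ _ x δ
  have hXc : Continuous fun u => skelFlowMapAt ω₂ lam β γ N T_L T_R u m z r x :=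
    continuous_skelFlowMapAt_time hω hl hβ hγ N T_L T_R m z r x
  have hAc : Continuous fun u => fderiv ℝ ((pinnedChain ω₂ lam β γ).drift N)
      (skelFlowMapAt ω₂ lam β γ N T_L T_R u m z r x) :=
    ((pinnedChain_contDiff_drift ω₂ lam β γ N (n := ⊤)).continuous_fderiv (by simp)).comp hXc
  have hac : Continuous fun u => driftA₀ ω₂ γ N + driftA₁ lam β N *
      √((pinnedChain ω₂ lam β γ).hamiltonian N
        (skelFlowMapAt ω₂ lam β γ N T_L T_R u m z r x)) :=
    continuous_const.add (continuous_const.mul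
      (((pinnedChain_continuous_hamiltonian ω₂ lam β γ N).comp hXc).sqrt))
  have hAa : ∀ t v, ‖(fderiv ℝ ((pinnedChain ω₂ lam β γ).drift N)
      (skelFlowMapAt ω₂ lam β γ N T_L T_R t m z r x)) v‖ ≤
      (driftA₀ ω₂ γ N + driftA₁ lam β N * √((pinnedChain ω₂ lam β γ).hamiltonian N
        (skelFlowMapAt ω₂ lam β γ N T_L T_R t m z r x))) * ‖v‖ :=
    fun t v => norm_fderiv_drift_apply_le hω hl hβ hγ N _ v
  have ha0 : ∀ t, 0 ≤ driftA₀ ω₂ γ N + driftA₁ lam β N *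
      √((pinnedChain ω₂ lam β γ).hamiltonian N
        (skelFlowMapAt ω₂ lam β γ N T_L T_R t m z r x)) :=
    fun t => add_nonneg (driftA₀_nonneg hω.le hγ N)
      (mul_nonneg (driftA₁_nonneg lam β N) (Real.sqrt_nonneg _))
  have hfb : ∀ τ ∈ Icc (0 : ℝ) 1, ‖(((0 : Fin N → ℝ), IccExtend zero_le_one
      (skelForcing N m (ampL ω₂ lam β γ T_L) (ampR ω₂ lam β γ T_R) δ) τ) : PhaseSpace N)‖ ≤
      max |ampL ω₂ lam β γ T_L| |ampR ω₂ lam β γ T_R| * skelAbsSum δ := by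
    intro τ hτ
    rw [IccExtend_of_mem _ _ hτ]
    exact norm_inr_skelForcing_apply_le N m _ _ δ ⟨τ, hτ⟩
  have hmain := norm_le_mul_exp_integral_of_eq_add_integral_of_norm_le (T := 1) hw hAc hac hAa
    ha0 hfb heq hs
  rw [fderiv_skelFlowMapAt_apply hω hl hβ hγ N T_L T_R hs m z r x δ]
  exact hmain

end Pathwise

/-! ## 6. (JMˣ)₂ The second skeleton variation — the ONE named leaf of part T

The first skeleton variation `D_x E^{s}_{m,z,r}(x)[δ]` IS a `pinnedChainVariation` (the adapted ramp
shift `skelForcing … δ` of the SAME flow, R `fderiv_skelFlowMapAt_apply`), which is why §3–§5 are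
S′ verbatim and (JMˣ)₁ is a theorem.  The SECOND variation `D²_x E^{s}(x)[δ, δ']` solves
`ẇ = D drift(E_u) w + D² drift(E_u)[D E[δ](u), D E[δ'](u)]`, `w(0) = 0`: its inhomogeneity is
quadratic in first variations and carries the second derivative of the drift — no noise shift
`η ↦ η + H δ` of the flow produces it, so by the critic's rule (rows 1077 (d), 1093 (g): «a named leaf
only if a skeleton direction is NOT realisable as a constant/adapted noise shift of the same flow») it
is recorded as a typed leaf with its plan, not claimed. -/

/-- **(JMˣ)₂ `SkeletonSecondVariationMoments`** — NAMED LEAF (ATTACKABLE-M), same quantifier shape as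
(JMˣ)₁: for positive parameters, `T > 0`, `N ≥ 1`, `q ≥ 1`, `ε > 0` there is `C` such that for all
`T_L, T_R ∈ [T/2, 2T]`, `0 ≤ s ≤ 1`, every level `m`, starting point `z` and skeleton directions
`δ, δ'`, `E ‖D²_Ξ X_s^{m}(z, R_m B, Ξ_m B)[δ, δ']‖^q ≤ (C · skelAbsSum δ · skelAbsSum δ' · e^{εH(z)})^q`
(the derivatives exist for every path: `contDiff_skelFlowMapAt` is `C^∞` in the skeleton).
PLAN (generation 80+, est. 600–900 lines): (i) Duhamel formula for the second variation from
`ContDiff ℝ ∞` in `x` and uniqueness for the linear inhomogeneous variational equation (the tree's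
`variational_unique` pattern), `D²E[δ,δ'](s) = ∫₀ˢ U(s,u) D²drift(E_u)[DE[δ](u), DE[δ'](u)] du` with `U`
the first-variation propagator; (ii) `‖D² drift(w)[v, v']‖ ≤ (B₀ + B₁ √H(w)) ‖v‖ ‖v'‖` — S′a's
`norm_fderiv_drift_apply_le` one derivative up (third derivatives of the pinning / interaction
potentials are dominated by `√H`); (iii) §3 for both first variations and §2 for `U` give the pathwise
majorant `skelAbsSum δ · skelAbsSum δ' · C' ∫₀ˢ (B₀ + B₁√H(E_u)) du · exp (3 ∫₀ˢ (A₀ + A₁ √H(E_u)) du)`;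
(iv) moments by §4 after absorbing the polynomial prefactor into the exponential (Young), keeping
`B₀ + B₁ √H(E_u)` INSIDE the time integral (Minkowski in `u`, as S′b) — no pathwise `sup_u H(E_u)`.
USE: discharges the `hGdu` / `hdum` hypotheses of the skeleton integration by parts
(`wienerPair_skeleton_ibp_skorokhod`) in part T-b's arrival / departure identities — `∂_j u_j`
contains `∂_j J = D²E[b_j, ·]` and `∂_j (Γ+κ)⁻¹ = −(Γ+κ)⁻¹ (∂_j Γ) (Γ+κ)⁻¹` — at every level `m`
and every `κ > 0`; it is NOT an (SWM)-type claim (no `κ → 0`, no level asymptotics; in the harmonic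
calibration `D²E ≡ 0`).  MUST-FAIL: `probes/MustFailTa.lean` F7. [route leaf · named hypothesis of this cell, NOT a literature fact]
(after Nualart2006, §2.2) [route leaf · named hypothesis of this cell, NOT filed as a literature fact] -/
def SkeletonSecondVariationMoments : Prop :=
  ∀ ω₂ lam β γ : ℝ, 0 < ω₂ → 0 < lam → 0 < β → 0 < γ →
    ∀ T : ℝ, 0 < T → ∀ N : ℕ, 0 < N → ∀ q ε : ℝ, 1 ≤ q → 0 < ε → ∃ C : ℝ,
      ∀ T_L T_R : ℝ, T / 2 ≤ T_L → T_L ≤ 2 * T → T / 2 ≤ T_R → T_R ≤ 2 * T →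
        ∀ s : ℝ, 0 ≤ s → s ≤ 1 → ∀ (m : ℕ) (z : PhaseSpace N) (δ δ' : PairSkeleton m),
          ∫⁻ wp, ENNReal.ofReal ‖fderiv ℝ (fun x => fderiv ℝ
              (skelFlowMapAt ω₂ lam β γ N T_L T_R s m z (pairRem m wp)) x δ) (pairSkel m wp) δ'‖ ^ q
              ∂wienerPair ≤
            ENNReal.ofReal ((C * skelAbsSum δ * skelAbsSum δ' *
              Real.exp (ε * (pinnedChain ω₂ lam β γ).hamiltonian N z)) ^ q)

/-- The second variation along the zero direction vanishes identically (the inner first variation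
is `0` for every skeleton), so the integrand of (JMˣ)₂ is `0` at `δ = 0`: the quantifier shape is
consistent (sanity `probes/SanityTa.lean` T8). [folklore] -/
theorem fderiv_fderiv_skelFlowMapAt_zero (ω₂ lam β γ : ℝ) (N : ℕ) (T_L T_R s : ℝ) (m : ℕ)
    (z : PhaseSpace N) (r : WienerPair) (x δ' : PairSkeleton m) :
    fderiv ℝ (fun y => fderiv ℝ (skelFlowMapAt ω₂ lam β γ N T_L T_R s m z r) y (0 : PairSkeleton m))
      x δ' = 0 := by
  have h : (fun y => fderiv ℝ (skelFlowMapAt ω₂ lam β γ N T_L T_R s m z r) y (0 : PairSkeleton m)) =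
      fun _ => (0 : PhaseSpace N) := funext fun y => map_zero _
  rw [h]
  simp

end Summit.AtomisticToContinuum.FouriersLaw.Theorems.ExtensiveSnapshotIrreversibility.EnergyWindow

end
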